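import Mathlib
import Summits.NavierStokesRegularity.NavierStokesRegularity.Theorems.WakeRatchetTailRatchetDSS
import HarnessLib

/-!
# Admissible self-similar cascades are SUB-UNITARY: the block energy ratio of a bounded admissible
# block-self-similar eternal solution is `≤ 1`; every non-trivial admissible DSS wave has `dssMu ≤ 1`

Support lemmas for the crux `WakeRatchet.TailRatchet` (stmt-NavierStokesRegularity-21808) — the DSS stratum
on which the crux, its rung `stub_rung_dss` and its repairs are analysed (`WakeRatchetTailRatchetDSS`,
`…DSSVisc`, `…NoBackwardDSS`).  Together with the delay kinematics (`inv_pow_lt_dssMu`: `(1+ε₀)^{-5} < dssMu`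
for `T > 0`) and `eq_zero_of_dss_nonpos_lag` (no lag `T ≤ 0`), the present file closes the KINEMATIC WINDOW of
admissible fronts from above:

* `blockRatio_le_one` — on a cancelling table, a NON-ZERO uniformly bounded admissible eternal solution (any
  covariant viscosity `ν̂ ≥ 0`) that is block-self-similar, `W_{n+p}(σ) = W_n(σ − T)`, has block energy ratio
  `ϱ = e^{2T} Λ^{-2p} ≤ 1`.  Proof: tails nest (`Σ_{k≥p} ≤ Σ_{k≥0}`) and scale (`tail_shift`:
  `Σ_k E_{n+p+k}(σ) = ϱ Σ_k E_{n+k}(σ−T)`), so `ϱ^j · Σ_k E_{n+k}(σ − jT) ≤ Σ_k E_{n+k}(σ) ≤ M`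
  (`TailEnvelopeFinite`); for `ϱ > 1` this forces the tail at a non-zero shell value to be `≤ ϱ^{-j} M → 0`.
* `IsDSSWave.dssMu_le_one` — hence every non-trivial admissible DSS wave (`IsDSSWave`, any period `q`, shape
  permutation `π`) of a cancelling table at `ε₀ > 0` has per-shell energy ratio `dssMu ε₀ T ≤ 1`: the
  heuristic «a wave reachable from finite-energy data is sub-unitary» of the definition `Surviving` holds for
  ALL admissible waves, and `IsDSSWave.surviving_five`'s hypothesis `dssMu < 1` can only fail at `dssMu = 1`.

MODEL lattice ODEs only (Tao 2016 §4, §6.4); nothing here concerns the Navier–Stokes equations.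
-/

noncomputable section

set_option linter.dupNamespace false

namespace Summit.NavierStokesRegularity.NavierStokesRegularity.Theorems

namespace WakeRatchetDSS

open Filter Topology
open Literature.Analysis.FluidPDE Literature.Analysis.FluidPDE.TaoCascade
open WakeRatchetTail

variable {m : ℕ} {ε₀ νh : ℝ} {α : Fin m → Fin m → Fin m → ℤ × ℤ × ℤ → ℝ} {W : ℤ → ℝ → Em m}

/-- Tails nest: `Σ_k E_{n+p+k}(σ) ≤ Σ_k E_{n+k}(σ)` (drop the first `p` non-negative terms).
[cite: Tao2016AveragedNS, §4 Lemma 4.1 (4.10); elementary] -/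
theorem tail_add_le_tail (hε : 0 < ε₀) (hU : UniformBound W) (n : ℤ) (p : ℕ) (σ : ℝ) :
    ∑' k : ℕ, physEnergy ε₀ W (n + p + k) σ ≤ ∑' k : ℕ, physEnergy ε₀ W (n + k) σ := by
  have hs := summable_tail hε hU n σ
  have hsplit := hs.sum_add_tsum_nat_add p
  have hshift : (fun k : ℕ => physEnergy ε₀ W (n + ((k + p : ℕ) : ℤ)) σ)
      = fun k : ℕ => physEnergy ε₀ W (n + p + k) σ := by
    funext k; push_cast; ring_nf
  rw [hshift] at hsplit
  have hnn : 0 ≤ ∑ i ∈ Finset.range p, physEnergy ε₀ W (n + (i : ℤ)) σ :=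
    Finset.sum_nonneg fun i _ => physEnergy_nonneg _ _ _ _
  linarith

/-- **Admissible block-self-similar cascades are sub-unitary.**  On a cancelling table, for `ε₀ > 0` and
any covariant viscosity `ν̂ ≥ 0`, a uniformly bounded admissible eternal solution with
`W_{n+p}(σ) = W_n(σ − T)` and a non-zero shell value has block energy ratio `e^{2T} Λ^{-2p} ≤ 1`.
[cite: Tao2016AveragedNS, §4 Lemma 4.1 (4.8)–(4.10) with (4.3), §6.4; cell vocabulary (`IsEternalVisc`, `UniformBound`)] -/
theorem blockRatio_le_one (hε : 0 < ε₀) (hc : IsCancellingCoeff α) (hW : IsEternalVisc ε₀ νh α W)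
    (hU : UniformBound W) {p : ℕ} {T : ℝ} (hD : ∀ (n : ℤ) (σ : ℝ), W (n + p) σ = W n (σ - T))
    {n₀ : ℤ} {σ₀ : ℝ} (hne : W n₀ σ₀ ≠ 0) :
    Real.exp (2 * T) * (bigLam ε₀ ^ p)⁻¹ ^ 2 ≤ 1 := by
  set ϱ : ℝ := Real.exp (2 * T) * (bigLam ε₀ ^ p)⁻¹ ^ 2 with hϱ
  by_contra hgt
  push Not at hgt
  have hρ0 : 0 < ϱ := blockRatio_pos hε p T
  set S : ℝ → ℝ := fun σ => ∑' k : ℕ, physEnergy ε₀ W (n₀ + k) σ with hS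
  obtain ⟨M, hM⟩ := TailEnvelopeFinite.main hε hc hW hU n₀
  -- one step: `ϱ · S(σ − T) ≤ S(σ)`
  have hstep : ∀ σ, ϱ * S (σ - T) ≤ S σ := by
    intro σ
    have h1 := tail_shift hε hD n₀ σ
    have h2 := tail_add_le_tail hε hU n₀ p σ
    simp only [hS]
    rw [← h1]
    exact h2
  -- iterate: `ϱ^j · S(σ₀) ≤ S(σ₀ + jT) ≤ M`
  have hiter : ∀ j : ℕ, ϱ ^ j * S σ₀ ≤ S (σ₀ + j * T) := by
    intro j
    induction j with
    | zero => simp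
    | succ j ih =>
      have h := hstep (σ₀ + (j + 1 : ℕ) * T)
      have e : σ₀ + ((j + 1 : ℕ) : ℝ) * T - T = σ₀ + (j : ℝ) * T := by push_cast; ring
      rw [e] at h
      calc ϱ ^ (j + 1) * S σ₀ = ϱ * (ϱ ^ j * S σ₀) := by ring
        _ ≤ ϱ * S (σ₀ + j * T) := mul_le_mul_of_nonneg_left ih hρ0.le
        _ ≤ S (σ₀ + ((j + 1 : ℕ) : ℝ) * T) := h
  have hbound : ∀ j : ℕ, ϱ ^ j * S σ₀ ≤ M := fun j => (hiter j).trans (hM _)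
  -- `S σ₀ > 0` from the non-zero shell value, so `ϱ^j ≤ M / S σ₀` for all `j`: absurd for `ϱ > 1`
  have hSpos : 0 < S σ₀ :=
    lt_of_lt_of_le (physEnergy_pos_of_ne hε hne) (physEnergy_le_tail hε hU n₀ σ₀)
  obtain ⟨j, hj⟩ := pow_unbounded_of_one_lt (M / S σ₀) hgt
  have h1 : ϱ ^ j ≤ M / S σ₀ := by rw [le_div_iff₀ hSpos]; exact hbound j
  linarith

/-- The block energy ratio of a DSS embedding over one period of the shape permutation is a power of
`dssMu`: `e^{2·(|π| T)} Λ^{-2|π|} = (dssMu ε₀ T)^{|π|}`.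
[cite: Tao2016AveragedNS, §4 (4.1); cell vocabulary (`dssMu`)] -/
theorem blockRatio_orderOf_eq_pow (hε : 0 ≤ ε₀) (p : ℕ) (T : ℝ) :
    Real.exp (2 * ((p : ℝ) * T)) * (bigLam ε₀ ^ p)⁻¹ ^ 2 = dssMu ε₀ T ^ p := by
  rw [inv_bigLam_pow_sq hε, show 2 * ((p : ℝ) * T) = (p : ℝ) * (2 * T) by ring, Real.exp_nat_mul,
    ← mul_pow]
  unfold dssMu
  rw [div_eq_mul_inv]

/-- **Every non-trivial admissible DSS wave is sub-unitary**: for a cancelling table, `ε₀ > 0`, and an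
admissible DSS wave `IsDSSWave ε₀ α π T Φ` (any period, any shape permutation) with a non-zero profile
value, the per-shell energy ratio satisfies `dssMu ε₀ T ≤ 1`.
[cite: Tao2016AveragedNS, §4 Lemma 4.1 (4.8)–(4.10) with (4.3), §6.4; cell vocabulary (`IsDSSWave`, `dssMu`, `Surviving`)] -/
theorem _root_.Literature.Analysis.FluidPDE.TaoCascade.IsDSSWave.dssMu_le_one {ρ : Type*} [Fintype ρ]
    {π : Equiv.Perm ρ} {T : ℝ} {Φ : ρ → ℝ → Em m} (hε : 0 < ε₀) (hc : IsCancellingCoeff α)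
    (h : IsDSSWave ε₀ α π T Φ) {r : ρ} {x : ℝ} (hne : Φ r x ≠ 0) : dssMu ε₀ T ≤ 1 := by
  have hp : 0 < orderOf π := orderOf_pos π
  have hW : IsEternalVisc ε₀ 0 α (dssEmbed π T Φ r) := (h.isEternal_dssEmbed r).isEternalVisc
  have hU : UniformBound (dssEmbed π T Φ r) := uniformBound_dssEmbed h r
  have hne' : dssEmbed π T Φ r 0 x ≠ 0 := by simpa [dssEmbed] using hne
  have hle := blockRatio_le_one hε hc hW hU (p := orderOf π) (T := orderOf π * T)
    (dssEmbed_shift π T Φ r) hne'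
  rw [blockRatio_orderOf_eq_pow hε.le] at hle
  exact (pow_le_one_iff_of_nonneg (dssMu_pos T (by linarith)).le hp.ne').1 hle

end WakeRatchetDSS

end Summit.NavierStokesRegularity.NavierStokesRegularity.Theorems

end
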